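import Summits.QuantumFields.YangMills.Theorems.BalabanLadderIRAbstractBasinRung24
import Summits.QuantumFields.YangMills.Theorems.BalabanLadderIRColdPurityBridgeRungs
import HarnessLib

/-!
# Line `diagonal-heredity` (idea-10 g2, LINE 4, lens «negation») — the one upward heredity the femto wall allows:
# raising the coupling by `Δ` costs at most ONE OCTAVE of box; with a window seed this ratchets to `E`

HONEST FRAMING. Nothing here proves the YM mass gap (Clay), `IR`, or `E`; R4 closes only the conditional finite-𝕋⁴ rung
`BalabanLadder.UV`.  This file is a crux WORKFILE (`sorry` only in the `stub_*` of §5); it is NOT a registered skeleton.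

## The line in one paragraph

The companion line `femto-wall` (LINE 3) types the NEGATIVE shape of the seed `E = ColdExitAt θ`
(`∀ (G,r) ∃ β₁ ∀ β ≥ β₁ ∃ L ≥ 8, δᶜ_β(L) ≤ θ`): at FIXED lattice size purity is never inherited upward in `β`
(`not_upwardHeredity_of_exitAt`) and every witness family `L(β) → ∞`.  The negation lens then asks: what is the weakest
UPWARD heredity that is consistent with the wall?  Answer: let the box move with the coupling along the renormalisation-group
DIAGONAL.  **Diagonal step** `D(θ, β₀, Δ)`: for every `β ≥ β₀` and every `θ`-pure box `L ≥ 8` at coupling `β`, SOME box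
`L' ∈ [8, 2L]` is `θ`-pure at coupling `β + Δ` — «one coupling increment `Δ` costs at most one octave of lattice box».
**Window seed** `W(θ, β₀, Δ)`: every coupling of ONE compact window `[β₀, β₀ + Δ]` has a `θ`-pure box.  Then (§2, PROVED,
Archimedean induction) `W ∧ D ⇒ ∀ β ≥ β₀ ∃ L ≥ 8, δᶜ_β(L) ≤ θ` — the body of `E` — and the witnesses are `L_k ≤ 2^k·L'`,
i.e. the purity length grows at most like `2^{(β−β₀)/Δ}` (§2, `exitScale_le_of_diagonal`): an EXPLICIT ceiling which
asymptotic freedom saturates (`a(β+Δ₂) = a(β)/2` with `Δ₂ → 8b₀·ln 2 ≈ 0.257` for `SU(2)`, `β = 4/g²`), so `D` can only hold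
for `Δ ≤ Δ₂` — the step IS one octave of AF running, typed without any continuum vocabulary.

On the STRONG-COUPLING window the seed is a TREE THEOREM (`ColdPurityBridge.coldExit_uniform_of_strongCoupling`, every
compact `G`): §3 proves `D` from `β₀ = r_ρ − Δ` ALONE gives the body of `E` (`exitBody_of_strongSeededStep`).  Honest caveat
(why the class-level stub keeps `β₀(G,r)` free): a first-order BULK transition on the Wilson axis (`SU(N ≥ 4)` fundamental,
Creutz 1981; mixed fundamental–adjoint `SU(2)` actions, Bhanot–Creutz 1981) makes EVERY box impure at the transition coupling
(two coexisting bulk phases ⇒ trace excess `≥ 1 − o(1)` ⇒ `δᶜ ≥ 1/2 − o(1)`), so the strong-seeded step is FALSE for such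
`(G, r)`; for `SU(2)`, `SU(3)` fundamental (smooth crossover, Creutz 1980) it is the physical expectation with `Δ ≲ 0.2`
(desk data: `β_c(N_t = 4, 8, 16) = 2.30, 2.51, 2.74`, one octave of `N_t` per `Δβ ≈ 0.21–0.23`).

GROUP SENSITIVITY (the lens' audit): `D ∧ W` is FALSE at `U(1)₄` — the ratchet from the confining strong-coupling window
must cross `β_c ≈ 1.01` into the Coulomb phase, where light electric flux makes every large box impure (LINE 1
`lightmode-exposure`, landed negative `Theorems/ColdExitSC/Negative/ColdExitFalseOfLightFlux.lean`); and FALSE at `SO(3)`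
(bulk transition + light `ℤ₂` flux).  So `D` carries confinement-persistence content («no deconfining bulk transition on the
Wilson axis», Creutz 2022 p.116 «no singularities are encountered») PLUS the AF octave rate — it is not group-blind.

SCALE audit (LINE 3): `D`'s witnesses double per step — consistent with the femto wall, which forbids exactly the `Δ`-step at
FIXED `L` (`UpwardHeredityAtRep`, refuted there).  `D` is the wall's complement: the minimal legal upward heredity.

## Contents
* §1 `WindowSeedAt`, `DiagonalStepAt`, `DiagonalHeredityAt` (per rep); class level `DiagonalHereditySC`.
* §2 PROVED: `ratchet` (induction), `exitBody_of_diagonalHeredityAt`, `exitScale_le_of_diagonal` (growth ceiling `2^k`),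
  `coldExitAt_of_diagonalHereditySC : DiagonalHereditySC θ → ColdExitAt θ`.
* §3 PROVED: `windowSeedAt_strongCoupling` (tree rung), `exitBody_of_strongSeededStep` (ONE hypothesis: the step from `r_ρ − Δ`).
* §4 PROVED: `octaveFreeStep_of_exitBody` — the octave-FREE step `(∃ pure box at β) → (∃ pure box at β+Δ)` is implied by `E`
  itself (so THAT form would be an `E`-costume; the octave bound `L' ≤ 2L` is what makes `D` a different, RG-shaped statement).
* §4b PROVED: the ROBUST form `DiagonalStepMinAt` (step asked only at the purity length), `exists_min_pure`, `exitBody_of_windowSeed_minStep`.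
* §5 bill by name: `stub_diagonalHeredity : DiagonalHeredityMinSC (1/24)`, `stub_afToColdPressure`, `stub_irnsc` ⊢
  `IR_of_stubs : Theses.BalabanLadder.IR` via the FIFTH RUNG `BasinRung.IR_of_exitAt24` (p604479).
-/

noncomputable section

open MeasureTheory Filter Topology
open Literature.MathematicalPhysics.QuantumFieldTheory Literature.MathematicalPhysics.QuantumLattice
open Literature.MathematicalPhysics.QuantumFieldTheory.Balaban1983to89.Missing (strongCouplingRadius
  strongCouplingRadius_pos)
open Summit.QuantumFields.YangMills.Cruxes.IR.ColdPurityBridge (coldDefect coldExit_uniform_of_strongCoupling)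
open Summit.QuantumFields.YangMills.Cruxes.IR.ColdPressurePincer (AFToColdPressure IRnsc)
open Summit.QuantumFields.YangMills.Cruxes.IR.BasinRung (ColdExitAt IR_of_exitAt24)

namespace Summit.QuantumFields.YangMills.Cruxes.IR.DiagonalHeredity

/-! ## §1 Definitions -/

section PerRep

variable {G : Type} [Group G] [TopologicalSpace G] [IsTopologicalGroup G] [CompactSpace G]
  [MeasurableSpace G] [BorelSpace G]

/-- **Window seed** `W(θ, β₀, Δ)` at `(G, r)`: every coupling of the compact window `[β₀, β₀ + Δ]` has a `θ`-pure cold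
box `L ≥ 8`.  (On the strong-coupling window a tree theorem: `windowSeedAt_strongCoupling`.) -/
def WindowSeedAt (r : LatticeRep G) (θ β₀ Δ : ℝ) : Prop :=
  ∀ β : ℝ, β₀ ≤ β → β ≤ β₀ + Δ → ∃ L : ℕ, 8 ≤ L ∧ coldDefect r.ρ β L ≤ θ

/-- **Diagonal step** `D(θ, β₀, Δ)` at `(G, r)` — the LOAD: beyond `β₀`, a `θ`-pure box `L` at coupling `β` forces a
`θ`-pure box `L' ∈ [8, 2L]` at coupling `β + Δ` («one increment `Δ` of inverse coupling costs at most one octave of box»;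
the RG reading: `(β + Δ, 2L)` and `(β, L)` are the same physical box when `a(β+Δ) = a(β)/2`). -/
def DiagonalStepAt (r : LatticeRep G) (θ β₀ Δ : ℝ) : Prop :=
  ∀ β : ℝ, β₀ ≤ β → ∀ L : ℕ, 8 ≤ L → coldDefect r.ρ β L ≤ θ →
    ∃ L' : ℕ, 8 ≤ L' ∧ L' ≤ 2 * L ∧ coldDefect r.ρ (β + Δ) L' ≤ θ

/-- **Diagonal heredity** at `(G, r)`: some window seed and the diagonal step with a common `(β₀, Δ)`, `Δ > 0`. -/
def DiagonalHeredityAt (r : LatticeRep G) (θ : ℝ) : Prop :=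
  ∃ β₀ Δ : ℝ, 0 < Δ ∧ WindowSeedAt r θ β₀ Δ ∧ DiagonalStepAt r θ β₀ Δ

/-! ## §2 The ratchet (PROVED): `W ∧ D ⇒` the body of `E`, with witnesses `≤ 2^k · L'` -/

/-- The induction: from the window, `k` diagonal steps reach `β + kΔ` with a pure box of size `≤ 2^k · L` for some seed box `L`. -/
theorem ratchet (r : LatticeRep G) {θ β₀ Δ : ℝ} (hΔ : 0 < Δ) (hW : WindowSeedAt r θ β₀ Δ)
    (hD : DiagonalStepAt r θ β₀ Δ) (k : ℕ) :
    ∀ β : ℝ, β₀ ≤ β → β ≤ β₀ + Δ →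
      ∃ L₀ : ℕ, 8 ≤ L₀ ∧ coldDefect r.ρ β L₀ ≤ θ ∧
        ∃ L : ℕ, 8 ≤ L ∧ L ≤ 2 ^ k * L₀ ∧ coldDefect r.ρ (β + k * Δ) L ≤ θ := by
  induction k with
  | zero =>
    intro β hβ hβ'
    obtain ⟨L, hL, hδ⟩ := hW β hβ hβ'
    exact ⟨L, hL, hδ, L, hL, by simp, by simpa using hδ⟩
  | succ k ih =>
    intro β hβ hβ'
    obtain ⟨L₀, hL₀, hδ₀, L, hL, hLle, hδ⟩ := ih β hβ hβ'
    have hβk : β₀ ≤ β + k * Δ := by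
      have : (0 : ℝ) ≤ k * Δ := mul_nonneg (Nat.cast_nonneg k) hΔ.le
      linarith
    obtain ⟨L', hL', hL'le, hδ'⟩ := hD (β + k * Δ) hβk L hL hδ
    refine ⟨L₀, hL₀, hδ₀, L', hL', ?_, ?_⟩
    · calc L' ≤ 2 * L := hL'le
        _ ≤ 2 * (2 ^ k * L₀) := Nat.mul_le_mul_left 2 hLle
        _ = 2 ^ (k + 1) * L₀ := by ring
    · have : β + ((k + 1 : ℕ) : ℝ) * Δ = β + k * Δ + Δ := by push_cast; ring
      rw [this]
      exact hδ'

/-- **`W ∧ D ⇒` the body of `E` at `(G, r)`** (PROVED): every `β ≥ β₀` has a `θ`-pure cold box `L ≥ 8`. -/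
theorem exitBody_of_diagonalHeredityAt (r : LatticeRep G) {θ : ℝ} (h : DiagonalHeredityAt r θ) :
    ∃ β₁ : ℝ, ∀ β : ℝ, β₁ ≤ β → ∃ L : ℕ, 8 ≤ L ∧ coldDefect r.ρ β L ≤ θ := by
  obtain ⟨β₀, Δ, hΔ, hW, hD⟩ := h
  refine ⟨β₀, fun β hβ => ?_⟩
  set k : ℕ := ⌊(β - β₀) / Δ⌋₊ with hk
  have hx : 0 ≤ (β - β₀) / Δ := div_nonneg (by linarith) hΔ.le
  have h1 : (k : ℝ) ≤ (β - β₀) / Δ := Nat.floor_le hx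
  have h2 : (β - β₀) / Δ < k + 1 := Nat.lt_floor_add_one _
  have h1' : (k : ℝ) * Δ ≤ β - β₀ := by rwa [le_div_iff₀ hΔ] at h1
  have h2' : β - β₀ < (k + 1) * Δ := by rwa [div_lt_iff₀ hΔ] at h2
  obtain ⟨L₀, -, -, L, hL, -, hδ⟩ :=
    ratchet r hΔ hW hD k (β - k * Δ) (by linarith) (by nlinarith)
  refine ⟨L, hL, ?_⟩
  have : β - k * Δ + k * Δ = β := by ring
  rwa [this] at hδ

/-- **Growth ceiling of the purity length** (PROVED): under `W ∧ D`, if the seed window has pure boxes of size `≤ L₁`, then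
at `β ∈ [β₀ + kΔ, β₀ + (k+1)Δ]` a pure box of size `≤ 2^k · L₁` exists — the exit scale grows at most like `2^{(β−β₀)/Δ}`.
(Asymptotic freedom saturates this: `L*(β) ≍ 1/a(β) ≍ e^{β/(8b₀)}` for `SU(2)`, so `D` forces `Δ ≤ 8b₀ ln 2`.) -/
theorem exitScale_le_of_diagonal (r : LatticeRep G) {θ β₀ Δ : ℝ} (hΔ : 0 < Δ) {L₁ : ℕ}
    (hW : ∀ β : ℝ, β₀ ≤ β → β ≤ β₀ + Δ → ∃ L : ℕ, 8 ≤ L ∧ L ≤ L₁ ∧ coldDefect r.ρ β L ≤ θ)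
    (hD : DiagonalStepAt r θ β₀ Δ) (k : ℕ) :
    ∀ β : ℝ, β₀ ≤ β → β ≤ β₀ + Δ →
      ∃ L : ℕ, 8 ≤ L ∧ L ≤ 2 ^ k * L₁ ∧ coldDefect r.ρ (β + k * Δ) L ≤ θ := by
  induction k with
  | zero =>
    intro β hβ hβ'
    obtain ⟨L, hL, hL₁, hδ⟩ := hW β hβ hβ'
    exact ⟨L, hL, by simpa using hL₁, by simpa using hδ⟩
  | succ k ih =>
    intro β hβ hβ'
    obtain ⟨L, hL, hLle, hδ⟩ := ih β hβ hβ'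
    have hβk : β₀ ≤ β + k * Δ := by
      have : (0 : ℝ) ≤ k * Δ := mul_nonneg (Nat.cast_nonneg k) hΔ.le
      linarith
    obtain ⟨L', hL', hL'le, hδ'⟩ := hD (β + k * Δ) hβk L hL hδ
    refine ⟨L', hL', ?_, ?_⟩
    · calc L' ≤ 2 * L := hL'le
        _ ≤ 2 * (2 ^ k * L₁) := Nat.mul_le_mul_left 2 hLle
        _ = 2 ^ (k + 1) * L₁ := by ring
    · have : β + ((k + 1 : ℕ) : ℝ) * Δ = β + k * Δ + Δ := by push_cast; ring
      rw [this]
      exact hδ'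

/-! ## §3 The strong-coupling seed is a TREE THEOREM (every compact `G`) -/

/-- **Window seed on the strong-coupling window (PROVED, group-blind)**: for `0 < θ` and `Δ ≤ r_ρ`
(`r_ρ = strongCouplingRadius r.ρ`), the window `[r_ρ − Δ, r_ρ]` is seeded, with boxes of ONE size `8k₁(θ)` —
`ColdPurityBridge.coldExit_uniform_of_strongCoupling` (Kotecký–Preiss polymer gas of the periodic boxes). -/
theorem windowSeedAt_strongCoupling (r : LatticeRep G) {θ Δ : ℝ} (hθ : 0 < θ)
    (hΔr : Δ ≤ strongCouplingRadius r.ρ) :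
    ∃ L₁ : ℕ, 8 ≤ L₁ ∧ ∀ β : ℝ, strongCouplingRadius r.ρ - Δ ≤ β → β ≤ strongCouplingRadius r.ρ - Δ + Δ →
      ∃ L : ℕ, 8 ≤ L ∧ L ≤ L₁ ∧ coldDefect r.ρ β L ≤ θ := by
  obtain ⟨k₁, hk₁, h⟩ := coldExit_uniform_of_strongCoupling r hθ
  refine ⟨8 * k₁, by omega, fun β hβ hβ' => ⟨8 * k₁, by omega, le_rfl, h β (by linarith) (by linarith) k₁ le_rfl⟩⟩

/-- **ONE hypothesis gives the body of `E` (PROVED): the diagonal step from the strong-coupling window.**  If `D(θ, r_ρ − Δ, Δ)`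
holds at `(G, r)` for some `0 < Δ ≤ r_ρ`, then every `β ≥ r_ρ − Δ` has a `θ`-pure cold box — the seed is the tree's
strong-coupling rung.  (Physically right for `SU(2)`, `SU(3)` fundamental; FALSE for `(G, r)` with a first-order bulk
transition on the Wilson axis — see the header; hence the class-level stub keeps `β₀` free.) -/
theorem exitBody_of_strongSeededStep (r : LatticeRep G) {θ Δ : ℝ} (hθ : 0 < θ) (hΔ : 0 < Δ)
    (hΔr : Δ ≤ strongCouplingRadius r.ρ)
    (hD : DiagonalStepAt r θ (strongCouplingRadius r.ρ - Δ) Δ) :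
    ∃ β₁ : ℝ, ∀ β : ℝ, β₁ ≤ β → ∃ L : ℕ, 8 ≤ L ∧ coldDefect r.ρ β L ≤ θ := by
  obtain ⟨L₁, -, hW⟩ := windowSeedAt_strongCoupling r hθ hΔr
  exact exitBody_of_diagonalHeredityAt r
    ⟨strongCouplingRadius r.ρ - Δ, Δ, hΔ, fun β hβ hβ' => by
      obtain ⟨L, hL, -, hδ⟩ := hW β hβ hβ'
      exact ⟨L, hL, hδ⟩, hD⟩

/-- **Growth ceiling from strong coupling (PROVED)**: under the strong-seeded step, at `β = r_ρ − Δ + s + kΔ`, `s ∈ [0, Δ]`,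
a `θ`-pure box of size `≤ 2^k · 8k₁(θ)` exists — purity length `≤ C(θ, r) · 2^{β/Δ}` along the whole Wilson axis. -/
theorem exitScale_le_of_strongSeededStep (r : LatticeRep G) {θ Δ : ℝ} (hθ : 0 < θ) (hΔ : 0 < Δ)
    (hΔr : Δ ≤ strongCouplingRadius r.ρ)
    (hD : DiagonalStepAt r θ (strongCouplingRadius r.ρ - Δ) Δ) :
    ∃ L₁ : ℕ, 8 ≤ L₁ ∧ ∀ k : ℕ, ∀ β : ℝ, strongCouplingRadius r.ρ - Δ ≤ β → β ≤ strongCouplingRadius r.ρ →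
      ∃ L : ℕ, 8 ≤ L ∧ L ≤ 2 ^ k * L₁ ∧ coldDefect r.ρ (β + k * Δ) L ≤ θ := by
  obtain ⟨L₁, hL₁, hW⟩ := windowSeedAt_strongCoupling r hθ hΔr
  exact ⟨L₁, hL₁, fun k β hβ hβ' =>
    exitScale_le_of_diagonal r hΔ hW hD k β hβ (by linarith)⟩

/-! ## §4 Why the octave bound is the content (PROVED): the octave-FREE step is an `E`-costume -/

/-- **The octave-free step is implied by the body of `E`** (PROVED): if every `β ≥ β₁` has a pure box, then trivially
«a pure box at `β` ⇒ a pure box at `β + Δ`» for `β ≥ β₁`, `Δ ≥ 0`.  So the statement WITHOUT `L' ≤ 2L` would be equivalent to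
`E` given the seed (a costume); the diagonal step's content is exactly the octave bound = the RG rate. -/
theorem octaveFreeStep_of_exitBody (r : LatticeRep G) {θ β₁ Δ : ℝ} (hΔ : 0 ≤ Δ)
    (hE : ∀ β : ℝ, β₁ ≤ β → ∃ L : ℕ, 8 ≤ L ∧ coldDefect r.ρ β L ≤ θ) :
    ∀ β : ℝ, β₁ ≤ β → (∃ L : ℕ, 8 ≤ L ∧ coldDefect r.ρ β L ≤ θ) →
      ∃ L' : ℕ, 8 ≤ L' ∧ coldDefect r.ρ (β + Δ) L' ≤ θ :=
  fun β hβ _ => hE (β + Δ) (by linarith [hΔ])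

/-! ## §4b The robust form (PROVED seams): ask the step only at the PURITY LENGTH -/

/-- **Minimal diagonal step** `D_min(θ, β₀, Δ)`: the octave step is asked only at the LEAST `θ`-pure size `L` at coupling `β`
(every `8 ≤ L'' < L` impure) — immune to «accidentally pure» small boxes in a non-monotone crossover.  Weaker than `D`
(`diagonalStepMinAt_of_diagonalStepAt`); same ratchet (`exitBody_of_windowSeed_minStep`). -/
def DiagonalStepMinAt (r : LatticeRep G) (θ β₀ Δ : ℝ) : Prop :=
  ∀ β : ℝ, β₀ ≤ β → ∀ L : ℕ, 8 ≤ L → coldDefect r.ρ β L ≤ θ →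
    (∀ L'' : ℕ, 8 ≤ L'' → L'' < L → θ < coldDefect r.ρ β L'') →
    ∃ L' : ℕ, 8 ≤ L' ∧ L' ≤ 2 * L ∧ coldDefect r.ρ (β + Δ) L' ≤ θ

theorem diagonalStepMinAt_of_diagonalStepAt (r : LatticeRep G) {θ β₀ Δ : ℝ} (h : DiagonalStepAt r θ β₀ Δ) :
    DiagonalStepMinAt r θ β₀ Δ :=
  fun β hβ L hL hδ _ => h β hβ L hL hδ

/-- From ANY pure box to the LEAST pure box (classical `Nat.find`). -/
theorem exists_min_pure (r : LatticeRep G) {θ β : ℝ} (h : ∃ L : ℕ, 8 ≤ L ∧ coldDefect r.ρ β L ≤ θ) :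
    ∃ L : ℕ, 8 ≤ L ∧ coldDefect r.ρ β L ≤ θ ∧ ∀ L'' : ℕ, 8 ≤ L'' → L'' < L → θ < coldDefect r.ρ β L'' := by
  classical
  refine ⟨Nat.find h, (Nat.find_spec h).1, (Nat.find_spec h).2, fun L'' hL'' hlt => ?_⟩
  have := Nat.find_min h hlt
  push Not at this
  exact this hL''

/-- **The robust ratchet (PROVED)**: `W ∧ D_min ⇒` the body of `E` at `(G, r)`. -/
theorem exitBody_of_windowSeed_minStep (r : LatticeRep G) {θ β₀ Δ : ℝ} (hΔ : 0 < Δ) (hW : WindowSeedAt r θ β₀ Δ)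
    (hD : DiagonalStepMinAt r θ β₀ Δ) :
    ∃ β₁ : ℝ, ∀ β : ℝ, β₁ ≤ β → ∃ L : ℕ, 8 ≤ L ∧ coldDefect r.ρ β L ≤ θ := by
  -- induction along the grid, carrying only existence of a pure box
  have step : ∀ k : ℕ, ∀ β : ℝ, β₀ ≤ β → β ≤ β₀ + Δ →
      ∃ L : ℕ, 8 ≤ L ∧ coldDefect r.ρ (β + k * Δ) L ≤ θ := by
    intro k
    induction k with
    | zero =>
      intro β hβ hβ'
      obtain ⟨L, hL, hδ⟩ := hW β hβ hβ'
      exact ⟨L, hL, by simpa using hδ⟩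
    | succ k ih =>
      intro β hβ hβ'
      obtain ⟨L, hL, hδ, hmin⟩ := exists_min_pure r (ih β hβ hβ')
      have hβk : β₀ ≤ β + k * Δ := by
        have : (0 : ℝ) ≤ k * Δ := mul_nonneg (Nat.cast_nonneg k) hΔ.le
        linarith
      obtain ⟨L', hL', -, hδ'⟩ := hD (β + k * Δ) hβk L hL hδ hmin
      refine ⟨L', hL', ?_⟩
      have : β + ((k + 1 : ℕ) : ℝ) * Δ = β + k * Δ + Δ := by push_cast; ring
      rw [this]
      exact hδ'
  refine ⟨β₀, fun β hβ => ?_⟩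
  set k : ℕ := ⌊(β - β₀) / Δ⌋₊ with hk
  have hx : 0 ≤ (β - β₀) / Δ := div_nonneg (by linarith) hΔ.le
  have h1 : (k : ℝ) ≤ (β - β₀) / Δ := Nat.floor_le hx
  have h2 : (β - β₀) / Δ < k + 1 := Nat.lt_floor_add_one _
  have h1' : (k : ℝ) * Δ ≤ β - β₀ := by rwa [le_div_iff₀ hΔ] at h1
  have h2' : β - β₀ < (k + 1) * Δ := by rwa [div_lt_iff₀ hΔ] at h2
  obtain ⟨L, hL, hδ⟩ := step k (β - k * Δ) (by linarith) (by nlinarith)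
  refine ⟨L, hL, ?_⟩
  have : β - k * Δ + k * Δ = β := by ring
  rwa [this] at hδ

/-- **Robust diagonal heredity** at `(G, r)`: window seed + MINIMAL diagonal step, common `(β₀, Δ)`. -/
def DiagonalHeredityMinAt (r : LatticeRep G) (θ : ℝ) : Prop :=
  ∃ β₀ Δ : ℝ, 0 < Δ ∧ WindowSeedAt r θ β₀ Δ ∧ DiagonalStepMinAt r θ β₀ Δ

theorem diagonalHeredityMinAt_of_diagonalHeredityAt (r : LatticeRep G) {θ : ℝ} (h : DiagonalHeredityAt r θ) :
    DiagonalHeredityMinAt r θ := by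
  obtain ⟨β₀, Δ, hΔ, hW, hD⟩ := h
  exact ⟨β₀, Δ, hΔ, hW, diagonalStepMinAt_of_diagonalStepAt r hD⟩

theorem exitBody_of_diagonalHeredityMinAt (r : LatticeRep G) {θ : ℝ} (h : DiagonalHeredityMinAt r θ) :
    ∃ β₁ : ℝ, ∀ β : ℝ, β₁ ≤ β → ∃ L : ℕ, 8 ≤ L ∧ coldDefect r.ρ β L ≤ θ := by
  obtain ⟨β₀, Δ, hΔ, hW, hD⟩ := h
  exact exitBody_of_windowSeed_minStep r hΔ hW hD

end PerRep

/-! ## §5 Class level and the bill -/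

/-- **`DiagonalHereditySC θ` — the engine-facing (stronger) class-level form**: for every compact simple simply-connected
`G` and every lattice representation, diagonal heredity at tolerance `θ` — a window seed `[β₀, β₀ + Δ]` and the diagonal step
«`θ`-pure `(β, L)` ⇒ `θ`-pure `(β + Δ, L')` for some `L' ∈ [8, 2L]`» for all `β ≥ β₀`, with `β₀ = β₀(G, r)` beyond the
lattice-artefact bulk transitions and `0 < Δ = Δ(G, r)` at most one octave of asymptotic-freedom running (`≤ 8b₀ ln 2` in
`β = 2N/g²` units).  Content: confinement persistence across the crossover («no deconfining bulk transition») + the AF octave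
rate; FALSE at `U(1)₄` (Coulomb phase beyond `β_c`) and at `SO(3)` (light `ℤ₂` flux) — group-sensitive as the lens demands.
Why it might fail as typed: a box `θ`-pure «by accident» far below the purity length (non-monotone `L ↦ δᶜ_β(L)` in the
femto ∕ deconfinement crossover of the `L/4`-box) need not have a pure partner `≤ 2L` one increment later — the LOAD below
(`DiagonalHeredityMinSC`) therefore asks the step only at the purity length.  Route-posited (no literature statement). -/
def DiagonalHereditySC (θ : ℝ) : Prop :=
  ∀ (G : Type) [Group G] [TopologicalSpace G] [IsTopologicalGroup G] [CompactSpace G],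
    IsCompactSimpleLieGroup G → SimplyConnectedSpace G →
    letI : MeasurableSpace G := borel G
    haveI : BorelSpace G := ⟨rfl⟩
    ∀ r : LatticeRep G, DiagonalHeredityAt r θ

/-- **STUB ∕ CRUX `DiagonalHeredityMinSC θ` (NEW, the LOAD of this line)**: as `DiagonalHereditySC` but the octave step is
asked only at the PURITY LENGTH `L*(β)` (the least `θ`-pure size): «`L*(β + Δ) ≤ 2·L*(β)` for all `β ≥ β₀(G, r)`» together
with one seeded window.  Equivalent wording: the purity length at tolerance `θ` at most DOUBLES per coupling increment `Δ`.
Weaker than `DiagonalHereditySC` (`diagonalHeredityMinSC_of_SC`).  Why it might fail: only if the purity length of `SU(N)`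
jumps by more than an octave somewhere beyond every `β₀` — a deconfining or bulk singularity at arbitrarily weak coupling, or
super-AF growth of `L*` (faster than `2^{β/Δ}` for every `Δ > 0`, i.e. faster than exponential in `β` — excluded by two-loop
asymptotic scaling `L* ≍ β^{p} e^{β/(8b₀)}` if scaling holds).  Sources: Creutz, Phys. Rev. D21 (1980) 2308 (SU(2) crossover,
no bulk transition); Creutz 2022 «Quarks, Gluons and Lattices» p.116; Montvay–Münster (1994) §3.7 p.162 («absence of any bulk
phase transition … widely believed»), (3.267) p.138 (asymptotic scaling).  Route-posited. -/
def DiagonalHeredityMinSC (θ : ℝ) : Prop :=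
  ∀ (G : Type) [Group G] [TopologicalSpace G] [IsTopologicalGroup G] [CompactSpace G],
    IsCompactSimpleLieGroup G → SimplyConnectedSpace G →
    letI : MeasurableSpace G := borel G
    haveI : BorelSpace G := ⟨rfl⟩
    ∀ r : LatticeRep G, DiagonalHeredityMinAt r θ

theorem diagonalHeredityMinSC_of_SC {θ : ℝ} (h : DiagonalHereditySC θ) : DiagonalHeredityMinSC θ := by
  intro G _ _ _ _ hG hsc
  letI : MeasurableSpace G := borel G
  haveI : BorelSpace G := ⟨rfl⟩
  intro r
  exact diagonalHeredityMinAt_of_diagonalHeredityAt r (h G hG hsc r)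

/-- **`DiagonalHeredityMinSC θ → ColdExitAt θ`** (PROVED): the robust ratchet at every `(G, r)` of `E`'s class. -/
theorem coldExitAt_of_diagonalHeredityMinSC {θ : ℝ} (h : DiagonalHeredityMinSC θ) : ColdExitAt θ := by
  intro G _ _ _ _ hG hsc
  letI : MeasurableSpace G := borel G
  haveI : BorelSpace G := ⟨rfl⟩
  intro r
  exact exitBody_of_diagonalHeredityMinAt r (h G hG hsc r)

/-- **`DiagonalHereditySC θ → ColdExitAt θ`** (PROVED). -/
theorem coldExitAt_of_diagonalHereditySC {θ : ℝ} (h : DiagonalHereditySC θ) : ColdExitAt θ :=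
  coldExitAt_of_diagonalHeredityMinSC (diagonalHeredityMinSC_of_SC h)

/-- STUB (NEW, the load): robust diagonal heredity at the desk's tolerance `1/24`. -/
theorem stub_diagonalHeredity : DiagonalHeredityMinSC (1 / 24) := by
  sorry

/-- STUB (shared with lines 10 ∕ 13 ∕ 20, by name): asymptotic freedom ⇒ cold pressure. -/
theorem stub_afToColdPressure : AFToColdPressure := by
  sorry

/-- STUB (shared, by name): the IR non-summability condition `IRnsc`. -/
theorem stub_irnsc : IRnsc := by
  sorry

/-- **The bill of this line, kernel-checked by name**: `IR ⇐ DiagonalHereditySC (1/24) ∧ X ∧ N` through the FIFTH RUNG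
`BasinRung.IR_of_exitAt24` (p604479).  Honest: width toward IR = the width of `D` (confinement persistence + AF rate), the
seed is finitely certifiable in principle (one compact window) and a tree theorem on the strong-coupling window. -/
theorem IR_of_stubs : Summit.QuantumFields.YangMills.Theses.BalabanLadder.IR :=
  IR_of_exitAt24 (coldExitAt_of_diagonalHeredityMinSC stub_diagonalHeredity) stub_afToColdPressure stub_irnsc

/-- The same bill with the hypotheses explicit (no sorry). -/
theorem IR_of_diagonalHeredity (hD : DiagonalHeredityMinSC (1 / 24)) (hX : AFToColdPressure) (hN : IRnsc) :
    Summit.QuantumFields.YangMills.Theses.BalabanLadder.IR :=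
  IR_of_exitAt24 (coldExitAt_of_diagonalHeredityMinSC hD) hX hN

/-- The engine-facing bill: the stronger plain form also pays (no sorry). -/
theorem IR_of_diagonalHereditySC (hD : DiagonalHereditySC (1 / 24)) (hX : AFToColdPressure) (hN : IRnsc) :
    Summit.QuantumFields.YangMills.Theses.BalabanLadder.IR :=
  IR_of_exitAt24 (coldExitAt_of_diagonalHereditySC hD) hX hN

end Summit.QuantumFields.YangMills.Cruxes.IR.DiagonalHeredity

end
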